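import Summits.QuantumFields.YangMills.Theorems.UnitScaleTiltProp7SymAvgTwDefs
import Summits.QuantumFields.YangMills.Theorems.UnitScaleTiltProp7SymAvgGLSmallOfRegPr
import Summits.QuantumFields.YangMills.Theorems.UnitScaleTiltProp7Chart5T3OfEq137cov
import Summits.QuantumFields.YangMills.Theorems.UnitScaleTiltProp7Chart48SymUntwisted
import HarnessLib

/-!
# `UnitScaleTiltProp7SymAvgTwEq137` — THE TWISTED CHART'S EQUATION IS (1.37)^cov: `logChartTw U₀ (iX) = log(V·Ū₀⁻¹)` ⟺ ★w5 g0's `D̄(e^{iX}U₀)(c) = w(c₋)·V(c)·w(c₊)⁻¹`, hence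
# the (20)∕(CH5EL) FIBRE CLAUSE («every (1.29)-restricted axial representative `(e^{iX}U₀)ᵘ` lies in the descent fibre of `V`») FROM PRINT'S EQUATION «Q_k(U₀, ηA) = B» IN THE
# TWISTED SYMMETRIC CHART OF RECORD, and from `Chart47T3tw` + `QTw∘H = id` + the datum ((48)-tw) — the fibre part of (CH5EL-tw) AS A THEOREM
# (route `UnitScaleTilt`, crux K1 «MinimiserStabilityRegPr» stmt-QuantumFields-19200, stub `stub_existenceMinimalOrbit` (EX), route (α), (S3)(i)∕(AVG-SYM); OWNER RULING g26-№1 Σ-TWIST (T),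
# item (3b); def-free, count-neutral)

Cell `ym3-torus` (HUMAN RULING D-0037, YM ladder rung R3 — YM₃ on T³ is a rung, not d = 4, not a mass gap, not Clay), width seat `ym-ust-20520-w5` (gen 3).

THE PRINT.  [Balaban1985RegularSpaces] p. 81 (1.30): «(Ũ₁^{u j})_b = u(b₋)(Ũ₁ʲ)_b u⁻¹(b₊) = V_b(Ū₀ʲ)_b⁻¹», p. 82: «(1.31) or (1/i) log Ũ₁ʲ = B on Λ_j … (1.37) Q_j(U₀, ηA) = B on Λ_j»; p. 83:
«the condition (1.37) is basically of an algebraic character and it follows from the construction, as in (1.30), (1.31)».  [Balaban1985Averaging] (87), (89)–(92) p. 31 (the double-bar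
average and `u = (\overline{R_{0,·}U₁}^{(k)})⁻¹` on the coarse lattice).  [Balaban1985Variational] (20) p. 281, (47)–(49) p. 285, Prop. 5 ∕ (112) p. 294.

WHAT IS PROVED (sorry-free, no definition; `w := frameTw U₀ (iX)` = `wrec L (U₀♯) ((e^{iX})♯) (K − n) ∘ coordT3`, `U̿ := dbarTw U₀ (iX)`; windows: `U₀` and `e^{iX}U₀` printed-regular with
`10⁷L³ε ≤ 1` — so the route's descents ARE the complexified ones, `Prop7SymAvgGLSmallOfRegPr.unitsField_toUField_descendTo_of_regPr` — and the two `log` windows `‖U̿(c) − 1‖ < 1`,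
`‖V(c)Ū₀(c)⁻¹ − 1‖ < 1`):
* §1 `unitsField_toUField_expHermField` (`(e^{iX})♭` in units; `(e^{iX}U₀)♭` is `Prop7Chart48SymUntwisted.unitsField_toUField_emb15_expHermField`), **`frameTw_smul_I_eq_wrec`** — the frame of `iX` IS the `wrec` letter of
  `Prop7ChartSigmaT3.gaugeAct_mem_fibre_iff_eq137cov_canonical` (`rfl` after §1).
* §2 **`dbarTw_eq_iff_eq137cov`** — `U̿(c) = V(c)♭·Ū₀(c)♭⁻¹ ⟺ (1.37)^cov at c` (group algebra `w₋⁻¹Dw₊D₀⁻¹ = VD₀⁻¹ ↔ D = w₋Vw₊⁻¹`, no window).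
* §3 ★**`logChartTw_eq_mlog_iff_eq137cov`** — the LOG form: `logChartTw U₀ (iX) c = log(V(c)·Ū₀(c)⁻¹) ⟺ (1.37)^cov at c` inside the `log` windows (`MatrixLog.exp_mlog`).
* §4 ★★**`fibreClause_of_logChartTw_eq_mlog`** — print's equation for every `c` ⟹ for EVERY (1.29)-restricted `u` with `(e^{iX}U₀)ᵘ` axial, `(e^{iX}U₀)ᵘ ∈ fibre F ℰp n K h V`
  (§3 ∘ p605215 `fibreClause_of_eq137cov`); ★`fibreClause_of_logChartTw_eq_zero` — the EX-stub case `U₀ ∈ 𝔅_k(V)` (B = 0).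
* §5 ★★**`fibreClause_of_chart47tw`** — THE FIBRE PART OF (CH5EL-tw): `Chart47T3tw … U₀ H` ∧ `QTw U₀ ∘ H = id` ∧ `‖A′‖ < ε` ∧ `QTw U₀ A′ = log(V·Ū₀⁻¹)` (the datum; in the knit from `QTw A₁ = 0`,
  `QTw(H₁B) = B`, PIN-B) ∧ `A′ − H(DA′) = iX` ⟹ the fibre clause — by (48)-tw (`Prop7SymAvgTw.logChartTw_eq_QTw_of_chart47tw`) and §4.
HONEST FRAMING.  Bookkeeping over landed letters and the defs of p605671; the windows are displayed hypotheses (their discharge from `RegPr` + the (19)-size of `X` is routine and not done here);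
nothing of print is asserted; the (21)∕(45)-tw and EL∕(112) parts of (CH5EL-tw) are untouched (RULING g26-№1 (3)).  `--supports stmt-QuantumFields-19200 --as helper`.

References: T. Bałaban, CMP 99 (1985) 75–102 [Balaban1985RegularSpaces] ((1.28)–(1.31) pp.81–82, (1.37) p.82, p.83); CMP 98 (1985) 17–51 [Balaban1985Averaging] ((85)–(92) p.31, (97) p.32,
(21)–(27) p.22); CMP 102 (1985) 277–309 [Balaban1985Variational] ((15) p.280, (19)–(20) p.281, (47)–(49) p.285, Prop. 3 p.289, Prop. 5 ∕ (112) p.294); CMP 99 (1985) 389–434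
[Balaban1985BackgroundPropagators] (p.392, (3.13)–(3.14) p.393).
-/

set_option autoImplicit false

noncomputable section

open scoped Matrix.Norms.L2Operator

namespace Summit.QuantumFields.YangMills.Theorems.Prop7SymAvgTwEq137

open NormedSpace
open Literature.MathematicalPhysics.QuantumFieldTheory.Balaban1983to89
open Literature.MathematicalPhysics.QuantumFieldTheory.Balaban1983to89.T3ContinuumYM3Torus
open T3LevelShift (siteShift)
open T3PrintedRegularOrbits (sites_eq)
open T3PrintedRegularMinimiser (RegPr)
open T3ConstrainedMinimiser (fibre)
open T3TiltDescent (descendTo)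
open T3UnitLawDensityEML (ℰp)
open T3SectALandauChart (bgUnits emb15)
open B7Prop1Explicit renaming Site → LSite
open B7Prop1Explicit (expUnit val_expUnit)
open B7Eq99Concrete (wrec)
open B10Eq27TorusAxialLog (pull unitsField toUField val_unitsField)
open B11Prop3Model (Dfix)
open MatrixLog (mlog mlog_one exp_mlog)
open Summit.QuantumFields.YangMills.Theorems.Prop7SPrint (basePt IsAxialPrint RestrictedPrint)
open Summit.QuantumFields.YangMills.Theorems.Prop7TPrint (expHermField expHermField_apply coe_expHerm)
open Summit.QuantumFields.YangMills.Theorems.Prop7SymAvgGL (descendToGL)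
open Summit.QuantumFields.YangMills.Theorems.Prop7SymAvgGLSmallOfRegPr (unitsField_toUField_descendTo_of_regPr bgUnits_eq)
open Summit.QuantumFields.YangMills.Theorems.Prop7SymAvgTw (coordT3 frameTw dbarTw logChartTw QTw CmapTw Chart47T3tw logChartTw_eq_QTw_of_chart47tw)
open Summit.QuantumFields.YangMills.Theorems.Prop7Chart5T3OfEq137cov (fibreClause_of_eq137cov)
open Summit.QuantumFields.YangMills.Theorems.Prop7Chart48SymUntwisted (unitsField_toUField_emb15_expHermField)

variable (F : T3Family) {n K : ℕ} (h : n ≤ K)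

/-! ## §1 The perturbation `e^{iX}` in units; the frame of `iX` IS ★w5 g0's `wrec` letter -/

/-- `(e^{iX})♭ = fun b => expUnit (iX b)` for bondwise Hermitian traceless `X`. [cite: Balaban1985Variational, (19) p.281, (112) p.294] -/
theorem unitsField_toUField_expHermField (X : PBond (F.P K) 0 → Matrix (Fin 2) (Fin 2) ℂ)
    (hX : ∀ b : PBond (F.P K) 0, (X b).IsHermitian ∧ Matrix.trace (X b) = 0) :
    unitsField (toUField (expHermField (F := F) X)) = fun b => expUnit (Complex.I • X b) := by
  funext b
  apply Units.ext
  rw [val_unitsField, val_expUnit, ← coe_expHerm (hX b), ← expHermField_apply]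
  rfl

/-- **THE FRAME OF `iX` IS THE `wrec` LETTER OF (1.37)^cov**: `frameTw U₀ (iX) y = wrec L (U₀♯) ((e^{iX})♯) (K − n) ((siteShift y)·val)` — the accumulated block frame of ★w5 g0's
`Prop7ChartSigmaT3.gaugeAct_mem_fibre_iff_eq137cov_canonical`, letter for letter. [cite: Balaban1985Averaging, (85)–(87) p.31, (97) p.32] -/
theorem frameTw_smul_I_eq_wrec (U₀ : GaugeField (F.P K) 0 (Matrix.specialUnitaryGroup (Fin 2) ℂ))
    (X : PBond (F.P K) 0 → Matrix (Fin 2) (Fin 2) ℂ) (hX : ∀ b : PBond (F.P K) 0, (X b).IsHermitian ∧ Matrix.trace (X b) = 0) (y : Site (F.P n) 0) :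
    frameTw F n K h U₀ (fun b => Complex.I • X b) y
      = wrec (F.P K).L (pull (unitsField (toUField U₀)) (basePt F n K)) (pull (unitsField (toUField (expHermField (F := F) X))) (basePt F n K)) (K - n)
          (fun μ => (((siteShift (sites_eq F n K h) y) μ).val : ℤ)) := by
  rw [unitsField_toUField_expHermField F X hX]
  rfl

/-! ## §2 The double-bar value `V·Ū₀⁻¹` IS (1.37)^cov (group algebra; no windows) -/

/-- Group algebra: `w₋⁻¹·D·w₊·D₀⁻¹ = V·D₀⁻¹ ↔ D = w₋·V·w₊⁻¹`. [folklore] -/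
theorem inv_mul_mul_mul_inv_eq_iff {G : Type*} [Group G] (wm wp D D₀ V : G) :
    wm⁻¹ * D * wp * D₀⁻¹ = V * D₀⁻¹ ↔ D = wm * V * wp⁻¹ := by
  rw [mul_left_inj, ← eq_mul_inv_iff_mul_eq, mul_assoc, inv_mul_eq_iff_eq_mul, ← mul_assoc]

/-- **`U̿^{tw}(iX)(c) = V(c)·Ū₀(c)⁻¹ ⟺ (1.37)^cov AT `c`** — print's (1.30)∕(1.31) «(Ũ₁^{u j})_b = u(b₋)(Ũ₁ʲ)_bu⁻¹(b₊) = V_b(Ū₀ʲ)_b⁻¹» for the symmetric fibre: with `U₀` and `e^{iX}U₀` printed-regular (so the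
route's descents ARE the complexified ones), the double-bar value equals `V·Ū₀⁻¹` exactly when `D̄(e^{iX}U₀)(c) = w(c₋)·V(c)·w(c₊)⁻¹` (★w5 g0's equation, canonical coordinates).
[cite: Balaban1985RegularSpaces, (1.30)–(1.31) pp.81–82, (1.37) p.82; Balaban1985Averaging, (89)–(92) p.31] -/
theorem dbarTw_eq_iff_eq137cov {ε₀ ε₁ : ℝ} (hε₀ : 0 < ε₀) (hε₀' : 10 ^ 7 * (F.L : ℝ) ^ 3 * ε₀ ≤ 1)
    (hε₁ : 0 < ε₁) (hε₁' : 10 ^ 7 * (F.L : ℝ) ^ 3 * ε₁ ≤ 1)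
    {U₀ : GaugeField (F.P K) 0 (Matrix.specialUnitaryGroup (Fin 2) ℂ)} (hU₀ : RegPr F n K ε₀ U₀)
    {X : PBond (F.P K) 0 → Matrix (Fin 2) (Fin 2) ℂ} (hX : ∀ b : PBond (F.P K) 0, (X b).IsHermitian ∧ Matrix.trace (X b) = 0)
    (hU₁ : RegPr F n K ε₁ (emb15 U₀ (expHermField X))) (V : GaugeField (F.P n) 0 (Matrix.specialUnitaryGroup (Fin 2) ℂ)) (c : PBond (F.P n) 0) :
    dbarTw F n K h U₀ (fun b => Complex.I • X b) c = unitsField (toUField V) c * (unitsField (toUField (descendTo F ℰp n K h U₀)) c)⁻¹ ↔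
      unitsField (toUField (descendTo F ℰp n K h (emb15 U₀ (expHermField X)))) c
        = wrec (F.P K).L (pull (unitsField (toUField U₀)) (basePt F n K)) (pull (unitsField (toUField (expHermField (F := F) X))) (basePt F n K)) (K - n)
            (fun μ => (((siteShift (sites_eq F n K h) c.src) μ).val : ℤ))
          * unitsField (toUField V) c
          * (wrec (F.P K).L (pull (unitsField (toUField U₀)) (basePt F n K)) (pull (unitsField (toUField (expHermField (F := F) X))) (basePt F n K)) (K - n)
            (fun μ => (((siteShift (sites_eq F n K h) c.tgt) μ).val : ℤ)))⁻¹ := by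
  have hD₀ : descendToGL F n K h (bgUnits F K U₀) = unitsField (toUField (descendTo F ℰp n K h U₀)) := by
    rw [bgUnits_eq]; exact (unitsField_toUField_descendTo_of_regPr F h hε₀ hε₀' hU₀).symm
  have hD₁ : descendToGL F n K h (fun b => expUnit (Complex.I • X b) * bgUnits F K U₀ b)
      = unitsField (toUField (descendTo F ℰp n K h (emb15 U₀ (expHermField X)))) := by
    rw [← unitsField_toUField_emb15_expHermField F U₀ X hX]
    exact (unitsField_toUField_descendTo_of_regPr F h hε₁ hε₁' hU₁).symm
  rw [Prop7SymAvgTw.dbarTw_def, hD₀, hD₁, frameTw_smul_I_eq_wrec F h U₀ X hX, frameTw_smul_I_eq_wrec F h U₀ X hX]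
  exact inv_mul_mul_mul_inv_eq_iff _ _ _ _ _

/-! ## §3 The log form: `logChartTw U₀ (iX) = log(V·Ū₀⁻¹)` ⟺ (1.37)^cov, inside the `log` windows -/

/-- `log` is injective on the window `‖· − 1‖ < 1` (`exp ∘ log = id` there). [cite: Balaban1985Averaging, (21)–(27) p.22] -/
theorem eq_of_mlog_eq {M N : Matrix (Fin 2) (Fin 2) ℂ} (hM : ‖M - 1‖ < 1) (hN : ‖N - 1‖ < 1) (hlog : mlog M = mlog N) : M = N := by
  rw [← exp_mlog hM, ← exp_mlog hN, hlog]

/-- ★ **(1.37) IN PRINT'S LOG FORM ⟺ (1.37)^cov**: for `U₀`, `e^{iX}U₀` printed-regular, `X` Hermitian traceless, inside the two `log` windows, `logChartTw U₀ (iX) c = log(V(c)·Ū₀(c)⁻¹)` («Q_k(U₀, ηA) = B»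
with print's datum `iB = log(V·Ū₀⁻¹)`, = `i·Bsym` of RULING (B20)) holds iff ★w5 g0's (1.37)^cov holds at `c`. [cite: Balaban1985RegularSpaces, (1.31) p.82, (1.37) p.82; Balaban1985Averaging, (89)–(92) p.31] -/
theorem logChartTw_eq_mlog_iff_eq137cov {ε₀ ε₁ : ℝ} (hε₀ : 0 < ε₀) (hε₀' : 10 ^ 7 * (F.L : ℝ) ^ 3 * ε₀ ≤ 1)
    (hε₁ : 0 < ε₁) (hε₁' : 10 ^ 7 * (F.L : ℝ) ^ 3 * ε₁ ≤ 1)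
    {U₀ : GaugeField (F.P K) 0 (Matrix.specialUnitaryGroup (Fin 2) ℂ)} (hU₀ : RegPr F n K ε₀ U₀)
    {X : PBond (F.P K) 0 → Matrix (Fin 2) (Fin 2) ℂ} (hX : ∀ b : PBond (F.P K) 0, (X b).IsHermitian ∧ Matrix.trace (X b) = 0)
    (hU₁ : RegPr F n K ε₁ (emb15 U₀ (expHermField X))) (V : GaugeField (F.P n) 0 (Matrix.specialUnitaryGroup (Fin 2) ℂ)) (c : PBond (F.P n) 0)
    (hwin : ‖((dbarTw F n K h U₀ (fun b => Complex.I • X b) c : (Matrix (Fin 2) (Fin 2) ℂ)ˣ) : Matrix (Fin 2) (Fin 2) ℂ) - 1‖ < 1)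
    (hwinV : ‖((unitsField (toUField V) c * (unitsField (toUField (descendTo F ℰp n K h U₀)) c)⁻¹ : (Matrix (Fin 2) (Fin 2) ℂ)ˣ) : Matrix (Fin 2) (Fin 2) ℂ) - 1‖ < 1) :
    logChartTw F n K h U₀ (fun b => Complex.I • X b) c
        = mlog (((unitsField (toUField V) c * (unitsField (toUField (descendTo F ℰp n K h U₀)) c)⁻¹ : (Matrix (Fin 2) (Fin 2) ℂ)ˣ) : Matrix (Fin 2) (Fin 2) ℂ)) ↔
      unitsField (toUField (descendTo F ℰp n K h (emb15 U₀ (expHermField X)))) c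
        = wrec (F.P K).L (pull (unitsField (toUField U₀)) (basePt F n K)) (pull (unitsField (toUField (expHermField (F := F) X))) (basePt F n K)) (K - n)
            (fun μ => (((siteShift (sites_eq F n K h) c.src) μ).val : ℤ))
          * unitsField (toUField V) c
          * (wrec (F.P K).L (pull (unitsField (toUField U₀)) (basePt F n K)) (pull (unitsField (toUField (expHermField (F := F) X))) (basePt F n K)) (K - n)
            (fun μ => (((siteShift (sites_eq F n K h) c.tgt) μ).val : ℤ)))⁻¹ := by
  rw [← dbarTw_eq_iff_eq137cov F h hε₀ hε₀' hε₁ hε₁' hU₀ hX hU₁ V c, Prop7SymAvgTw.logChartTw_apply]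
  constructor
  · intro hlog
    exact Units.ext (eq_of_mlog_eq hwin hwinV hlog)
  · intro heq
    rw [heq]

/-! ## §4 The fibre clause of (20)∕(CH5EL) from the twisted log-chart equation -/

/-- ★★ **THE (20)-FIBRE CLAUSE FROM PRINT'S EQUATION (1.37) IN THE TWISTED CHART**: if `logChartTw U₀ (iX) = log(V·Ū₀⁻¹)` bondwise on the comparison lattice (inside the windows; `U₀`,
`e^{iX}U₀` printed-regular; `X` Hermitian traceless), then EVERY (1.29)-restricted `u` with `(e^{iX}U₀)ᵘ` axial puts `(e^{iX}U₀)ᵘ` in the descent fibre of `V` — §3 ∘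
`Prop7Chart5T3OfEq137cov.fibreClause_of_eq137cov` (p605215).  This is the (20)-fibre part of (CH5EL-tw) (RULING g26-№1 (3)).
[cite: Balaban1985RegularSpaces, (1.28)–(1.31) pp.81–82, (1.37) p.82; Balaban1985Variational, (20) p.281, Prop. 5 p.294] -/
theorem fibreClause_of_logChartTw_eq_mlog {ε₀ ε₁ : ℝ} (hε₀ : 0 < ε₀) (hε₀' : 10 ^ 7 * (F.L : ℝ) ^ 3 * ε₀ ≤ 1)
    (hε₁ : 0 < ε₁) (hε₁' : 10 ^ 7 * (F.L : ℝ) ^ 3 * ε₁ ≤ 1)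
    {U₀ : GaugeField (F.P K) 0 (Matrix.specialUnitaryGroup (Fin 2) ℂ)} (hU₀ : RegPr F n K ε₀ U₀)
    {X : PBond (F.P K) 0 → Matrix (Fin 2) (Fin 2) ℂ} (hX : ∀ b : PBond (F.P K) 0, (X b).IsHermitian ∧ Matrix.trace (X b) = 0)
    (hU₁ : RegPr F n K ε₁ (emb15 U₀ (expHermField X))) (V : GaugeField (F.P n) 0 (Matrix.specialUnitaryGroup (Fin 2) ℂ))
    (hwin : ∀ c : PBond (F.P n) 0, ‖((dbarTw F n K h U₀ (fun b => Complex.I • X b) c : (Matrix (Fin 2) (Fin 2) ℂ)ˣ) : Matrix (Fin 2) (Fin 2) ℂ) - 1‖ < 1)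
    (hwinV : ∀ c : PBond (F.P n) 0,
      ‖((unitsField (toUField V) c * (unitsField (toUField (descendTo F ℰp n K h U₀)) c)⁻¹ : (Matrix (Fin 2) (Fin 2) ℂ)ˣ) : Matrix (Fin 2) (Fin 2) ℂ) - 1‖ < 1)
    (hlog : ∀ c : PBond (F.P n) 0, logChartTw F n K h U₀ (fun b => Complex.I • X b) c
        = mlog (((unitsField (toUField V) c * (unitsField (toUField (descendTo F ℰp n K h U₀)) c)⁻¹ : (Matrix (Fin 2) (Fin 2) ℂ)ˣ) : Matrix (Fin 2) (Fin 2) ℂ))) :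
    ∀ u : GaugeTransf (F.P K) 0 (Matrix.specialUnitaryGroup (Fin 2) ℂ), RestrictedPrint F n K U₀ u →
      IsAxialPrint F n K U₀ (GaugeField.gaugeAct u (emb15 U₀ (expHermField X))) →
        GaugeField.gaugeAct u (emb15 U₀ (expHermField X)) ∈ fibre F ℰp n K h V :=
  fibreClause_of_eq137cov F h U₀ V X fun c =>
    (logChartTw_eq_mlog_iff_eq137cov F h hε₀ hε₀' hε₁ hε₁' hU₀ hX hU₁ V c (hwin c) (hwinV c)).1 (hlog c)

/-- ★ **THE EX-STUB CASE `U₀ ∈ 𝔅_k(V)` (B = 0)**: the background in the fibre of `V` (a hypothesis of `stub_existenceMinimalOrbit`), `logChartTw U₀ (iX) = 0`, the windows ⟹ the (20)-fibre clause for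
every restricted axial `u`. [cite: Balaban1985RegularSpaces, (1.13) p.78, (1.37) p.82; Balaban1985Variational, (20) p.281] -/
theorem fibreClause_of_logChartTw_eq_zero {ε₀ ε₁ : ℝ} (hε₀ : 0 < ε₀) (hε₀' : 10 ^ 7 * (F.L : ℝ) ^ 3 * ε₀ ≤ 1)
    (hε₁ : 0 < ε₁) (hε₁' : 10 ^ 7 * (F.L : ℝ) ^ 3 * ε₁ ≤ 1)
    {V : GaugeField (F.P n) 0 (Matrix.specialUnitaryGroup (Fin 2) ℂ)}
    {U₀ : GaugeField (F.P K) 0 (Matrix.specialUnitaryGroup (Fin 2) ℂ)} (hU₀V : U₀ ∈ fibre F ℰp n K h V) (hU₀ : RegPr F n K ε₀ U₀)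
    {X : PBond (F.P K) 0 → Matrix (Fin 2) (Fin 2) ℂ} (hX : ∀ b : PBond (F.P K) 0, (X b).IsHermitian ∧ Matrix.trace (X b) = 0)
    (hU₁ : RegPr F n K ε₁ (emb15 U₀ (expHermField X)))
    (hwin : ∀ c : PBond (F.P n) 0, ‖((dbarTw F n K h U₀ (fun b => Complex.I • X b) c : (Matrix (Fin 2) (Fin 2) ℂ)ˣ) : Matrix (Fin 2) (Fin 2) ℂ) - 1‖ < 1)
    (hlog : logChartTw F n K h U₀ (fun b => Complex.I • X b) = 0) :
    ∀ u : GaugeTransf (F.P K) 0 (Matrix.specialUnitaryGroup (Fin 2) ℂ), RestrictedPrint F n K U₀ u →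
      IsAxialPrint F n K U₀ (GaugeField.gaugeAct u (emb15 U₀ (expHermField X))) →
        GaugeField.gaugeAct u (emb15 U₀ (expHermField X)) ∈ fibre F ℰp n K h V := by
  have hV : descendTo F ℰp n K h U₀ = V := hU₀V
  have h1 : ∀ c : PBond (F.P n) 0, unitsField (toUField V) c * (unitsField (toUField (descendTo F ℰp n K h U₀)) c)⁻¹ = 1 := fun c => by
    rw [hV, mul_inv_cancel]
  refine fibreClause_of_logChartTw_eq_mlog F h hε₀ hε₀' hε₁ hε₁' hU₀ hX hU₁ V hwin (fun c => ?_) fun c => ?_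
  · rw [h1, Units.val_one, sub_self, norm_zero]; exact one_pos
  · rw [hlog, h1, Units.val_one, mlog_one]; rfl

/-! ## §5 (CH5EL-tw)'s fibre part from the twisted chart: (48)-tw ∘ datum ∘ §4 -/

/-- ★★ **THE FIBRE PART OF (CH5EL-tw) AS A THEOREM** (RULING g26-№1 (3)): the twisted chart `Chart47T3tw … U₀ H` with `QTw U₀ ∘ H = id` ((45)–(46)-tw), a chart parameter `A′` (‖A′‖ < ε) whose
twisted linear average is print's datum `Q(U₀)A′ = log(V·Ū₀⁻¹)` ((20): «Q_k(U₀, ηA) = B», `iB`-form) and whose image `A′ − H(DA′) = iX` has `X` Hermitian traceless, inside the regularity and `log`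
windows ⟹ for EVERY (1.29)-restricted `u` with `(e^{iX}U₀)ᵘ` axial, `(e^{iX}U₀)ᵘ ∈ fibre F ℰp n K h V` — (48)-tw (`Prop7SymAvgTw.logChartTw_eq_QTw_of_chart47tw`) then §4.  (In the knit: `A′ = A₁ + H₁B`
with `QTw A₁ = 0`, `QTw(H₁B) = B` supplies the datum hypothesis.) [cite: Balaban1985Variational, (47)–(49) p.285, Prop. 3 p.289, Prop. 5 p.294, (112) p.294, (20) p.281; Balaban1985RegularSpaces, (1.37) p.82] -/
theorem fibreClause_of_chart47tw {C₂ ε ε₀ ε₁ : ℝ} (hε₀ : 0 < ε₀) (hε₀' : 10 ^ 7 * (F.L : ℝ) ^ 3 * ε₀ ≤ 1)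
    (hε₁ : 0 < ε₁) (hε₁' : 10 ^ 7 * (F.L : ℝ) ^ 3 * ε₁ ≤ 1)
    {U₀ : GaugeField (F.P K) 0 (Matrix.specialUnitaryGroup (Fin 2) ℂ)} (hU₀ : RegPr F n K ε₀ U₀)
    {H : (PBond (F.P n) 0 → Matrix (Fin 2) (Fin 2) ℂ) →ₗ[ℂ] (PBond (F.P K) 0 → Matrix (Fin 2) (Fin 2) ℂ)}
    (h47 : Chart47T3tw F n K h C₂ ε U₀ H) (hQH : ∀ Y, QTw F n K h U₀ (H Y) = Y)
    (V : GaugeField (F.P n) 0 (Matrix.specialUnitaryGroup (Fin 2) ℂ))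
    (A' : PBond (F.P K) 0 → Matrix (Fin 2) (Fin 2) ℂ) (hA' : ‖A'‖ < ε)
    (hQA' : QTw F n K h U₀ A'
      = fun c => mlog (((unitsField (toUField V) c * (unitsField (toUField (descendTo F ℰp n K h U₀)) c)⁻¹ : (Matrix (Fin 2) (Fin 2) ℂ)ˣ) : Matrix (Fin 2) (Fin 2) ℂ)))
    {X : PBond (F.P K) 0 → Matrix (Fin 2) (Fin 2) ℂ} (hX : ∀ b : PBond (F.P K) 0, (X b).IsHermitian ∧ Matrix.trace (X b) = 0)
    (hAX : A' - H (Dfix (CmapTw F n K h U₀) H C₂ A') = fun b => Complex.I • X b)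
    (hU₁ : RegPr F n K ε₁ (emb15 U₀ (expHermField X)))
    (hwin : ∀ c : PBond (F.P n) 0, ‖((dbarTw F n K h U₀ (fun b => Complex.I • X b) c : (Matrix (Fin 2) (Fin 2) ℂ)ˣ) : Matrix (Fin 2) (Fin 2) ℂ) - 1‖ < 1)
    (hwinV : ∀ c : PBond (F.P n) 0,
      ‖((unitsField (toUField V) c * (unitsField (toUField (descendTo F ℰp n K h U₀)) c)⁻¹ : (Matrix (Fin 2) (Fin 2) ℂ)ˣ) : Matrix (Fin 2) (Fin 2) ℂ) - 1‖ < 1) :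
    ∀ u : GaugeTransf (F.P K) 0 (Matrix.specialUnitaryGroup (Fin 2) ℂ), RestrictedPrint F n K U₀ u →
      IsAxialPrint F n K U₀ (GaugeField.gaugeAct u (emb15 U₀ (expHermField X))) →
        GaugeField.gaugeAct u (emb15 U₀ (expHermField X)) ∈ fibre F ℰp n K h V := by
  have h48 := logChartTw_eq_QTw_of_chart47tw h47 hQH A' hA'
  rw [hAX, hQA'] at h48
  exact fibreClause_of_logChartTw_eq_mlog F h hε₀ hε₀' hε₁ hε₁' hU₀ hX hU₁ V hwin hwinV fun c => congrFun h48 c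

end Summit.QuantumFields.YangMills.Theorems.Prop7SymAvgTwEq137

end
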